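import Summits.NavierStokesRegularity.NavierStokesRegularity.Theorems.SoloRefuteHaitani2025B0Moments

/-!
# C133 `Haitani2025` — B₀, file F1c: orthogonality of the 1-D dyadic family

Towards the case-(α) ADDENDUM `¬ Step1_Display13 B₀` (chair 2026-08-27T05:18:12Z). Over F1a/F1b:
`∫₀¹ spS k j · spS k' j' = 0` whenever `(k,j) ≠ (k',j')` (`j < 2^k`, `j' < 2^k'`).
* same level `k = k'`, `j ≠ j'`: the supports `[j/2^k,(j+1)/2^k]`, `[j'/2^k,(j'+1)/2^k]` have disjoint
  interiors and the mother vanishes at the end points, so the product vanishes identically;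
* `k < k'`: the fine support `[j'/2^k', (j'+1)/2^k']` lies inside ONE dyadic interval of generation `k+1`,
  on which the coarse factor `spS k j` is a single polynomial of degree `≤ 6` (`P`, `Q` or `0` composed with
  an affine map); after the substitution `y = 2^k' x − j'` the integral is `2^{-k'} ∫₀¹ p(y) sp(y) dy = 0` by
  the seven vanishing moments (`integral_polynomial_mul_sp`, F1b).
This is the exact mechanism that makes the tensor system B₀ satisfy Definition 1 item 3 across all levels.
[cite: Haitani2025NavierStokesGitHub, Definition 1 p.2; (13) p.4]

WHAT THIS IS NOT: not a claim about NS regularity or blow-up; not a claim about any author beyond the typed locator.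
-/

set_option linter.dupNamespace false

open Set Filter Topology intervalIntegral MeasureTheory Polynomial

namespace Summit.NavierStokesRegularity.NavierStokesRegularity.Theorems.Haitani2025.B0

noncomputable section

/-! ### The pieces as `Polynomial ℝ` -/

/-- `P` as a polynomial. [folklore] -/
def PX : ℝ[X] := -X ^ 2 + C 20 * X ^ 3 - C 125 * X ^ 4 + C 306 * X ^ 5 - C 256 * X ^ 6

/-- `Q` as a polynomial. [folklore] -/
def QX : ℝ[X] := C 56 - C 448 * X + C 1471 * X ^ 2 - C 2540 * X ^ 3 + C 2435 * X ^ 4 - C 1230 * X ^ 5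
  + C 256 * X ^ 6

/-- `PX` evaluates to `P`. [folklore] -/
theorem eval_PX (x : ℝ) : PX.eval x = P x := by simp [PX, P]

/-- `QX` evaluates to `Q`. [folklore] -/
theorem eval_QX (x : ℝ) : QX.eval x = Q x := by simp [QX, Q]

/-- `deg PX ≤ 6`. [folklore] -/
theorem natDegree_PX : PX.natDegree ≤ 6 := by unfold PX; compute_degree

/-- `deg QX ≤ 6`. [folklore] -/
theorem natDegree_QX : QX.natDegree ≤ 6 := by unfold QX; compute_degree

/-- Degree `≤ 6` is stable under affine substitution. [folklore] -/
theorem natDegree_comp_affine_le {p : ℝ[X]} (hp : p.natDegree ≤ 6) (α β : ℝ) :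
    (p.comp (C α * X + C β)).natDegree ≤ 6 := by
  have hlin : (C α * X + C β : ℝ[X]).natDegree ≤ 1 := by compute_degree
  calc (p.comp (C α * X + C β)).natDegree ≤ p.natDegree * (C α * X + C β : ℝ[X]).natDegree :=
        natDegree_comp_le
    _ ≤ 6 * 1 := Nat.mul_le_mul hp hlin
    _ = 6 := by norm_num

/-! ### Same level: disjoint supports -/

/-- Same level, different translates: the product vanishes identically. [folklore] -/
theorem spS_mul_spS_same_level {k j j' : ℕ} (h : j ≠ j') (x : ℝ) : spS k j x * spS k j' x = 0 := by
  wlog hlt : j < j' generalizing j j'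
  · rw [mul_comm]; exact this h.symm (lt_of_le_of_ne (not_lt.1 hlt) h.symm)
  rcases le_or_gt x (j' / 2 ^ k) with hx | hx
  · rw [spS_eq_zero_of_le (k := k) (j := j') hx, mul_zero]
  · have hx' := (div_lt_iff₀ (two_pow_pos' k)).1 hx
    have hjj : (j:ℝ) + 1 ≤ j' := by exact_mod_cast hlt
    have : ((j:ℝ) + 1) / 2 ^ k ≤ x := by
      rw [div_le_iff₀ (two_pow_pos' k)]; linarith
    rw [spS_eq_zero_of_ge this, zero_mul]

/-! ### Across levels: the moment mechanism -/

/-- On a dyadic interval of generation `k+1` (index `i`), the coarse factor `spS k j` is one polynomial of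
degree `≤ 6` in the local variable: `P`, `Q` or `0` according to `i = 2j`, `i = 2j+1`, or otherwise. Phrased
with the fine local coordinate `z = 2^(k+1+d) x − j' ∈ [0,1]` of a descendant `(k+1+d, j')` of `i`.
[folklore] -/
theorem spS_eq_eval_on_descendant {k d j j' i : ℕ} (hi1 : i * 2 ^ d ≤ j') (hi2 : j' + 1 ≤ (i + 1) * 2 ^ d)
    {x : ℝ} (hz0 : 0 ≤ (2:ℝ) ^ (k + 1 + d) * x - j') (hz1 : (2:ℝ) ^ (k + 1 + d) * x - j' ≤ 1) :
    spS k j x = (if i = 2 * j then PX else if i = 2 * j + 1 then QX else 0).eval (2 ^ k * x - j) := by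
  have hK : (0:ℝ) < 2 ^ k := two_pow_pos' k
  have hD : (0:ℝ) < 2 ^ d := two_pow_pos' d
  have hpow : (2:ℝ) ^ (k + 1 + d) = 2 ^ k * 2 * 2 ^ d := by rw [pow_add, pow_succ]
  have hi1' : (i:ℝ) * 2 ^ d ≤ j' := by exact_mod_cast hi1
  have hi2' : (j':ℝ) + 1 ≤ ((i:ℝ) + 1) * 2 ^ d := by exact_mod_cast hi2
  set z : ℝ := (2:ℝ) ^ (k + 1 + d) * x - j' with hz
  -- the coarse local variable in terms of z
  have ht : (2:ℝ) ^ k * x - j = (z + j' - 2 * j * 2 ^ d) / (2 * 2 ^ d) := by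
    rw [hz, hpow]; field_simp; ring
  by_cases h1 : i = 2 * j
  · subst h1
    rw [if_pos rfl, eval_PX]
    have hi1'' : (2:ℝ) * j * 2 ^ d ≤ j' := by push_cast at hi1'; linarith
    have hi2'' : (j':ℝ) + 1 ≤ (2 * j + 1) * 2 ^ d := by push_cast at hi2'; linarith
    apply sp_of_mem_left
    · rw [ht]; exact div_nonneg (by linarith) (by positivity)
    · rw [ht, div_le_iff₀ (by positivity)]; nlinarith
  by_cases h2 : i = 2 * j + 1
  · subst h2
    rw [if_neg h1, if_pos rfl, eval_QX]
    have hi1'' : ((2:ℝ) * j + 1) * 2 ^ d ≤ j' := by push_cast at hi1'; linarith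
    have hi2'' : (j':ℝ) + 1 ≤ (2 * j + 2) * 2 ^ d := by push_cast at hi2'; linarith
    apply sp_of_mem_right
    · rw [ht, le_div_iff₀ (by positivity)]; nlinarith
    · rw [ht, div_le_iff₀ (by positivity)]; nlinarith
  rw [if_neg h1, if_neg h2, eval_zero]
  rcases Nat.lt_or_ge i (2 * j) with h3 | h3
  · -- i + 1 ≤ 2j : the interval lies left of the coarse support
    have h3' : (i:ℝ) + 1 ≤ 2 * j := by exact_mod_cast h3
    apply sp_of_nonpos
    rw [ht, div_le_iff₀ (by positivity)]; nlinarith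
  · -- i ≥ 2j + 2 : right of the coarse support
    have h4 : 2 * j + 2 ≤ i := by omega
    have h4' : (2:ℝ) * j + 2 ≤ i := by exact_mod_cast h4
    apply sp_of_one_le
    rw [ht, le_div_iff₀ (by positivity)]; nlinarith

/-- Cross-level orthogonality, `k < k'`. [folklore] -/
theorem integral_spS_mul_spS_of_lt {k j k' j' : ℕ} (hkk : k < k') (hj' : j' < 2 ^ k') :
    ∫ x in (0:ℝ)..1, spS k j x * spS k' j' x = 0 := by
  obtain ⟨d, rfl⟩ : ∃ d, k' = k + 1 + d := ⟨k' - k - 1, by omega⟩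
  -- ancestor index at generation k+1
  obtain ⟨i, hi⟩ : ∃ i, i = j' / 2 ^ d := ⟨_, rfl⟩
  have hDpos : 0 < 2 ^ d := pow_pos (by norm_num) d
  have hi1 : i * 2 ^ d ≤ j' := by rw [hi]; exact Nat.div_mul_le_self j' (2 ^ d)
  have hi2 : j' + 1 ≤ (i + 1) * 2 ^ d := by
    have := Nat.lt_div_mul_add (a := j') hDpos
    rw [hi, add_mul, one_mul]; omega
  have hK' : (0:ℝ) < 2 ^ (k + 1 + d) := two_pow_pos' _
  have hj'' : (j':ℝ) + 1 ≤ 2 ^ (k + 1 + d) := by exact_mod_cast hj'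
  set A : ℝ := j' / 2 ^ (k + 1 + d) with hA
  set B : ℝ := ((j':ℝ) + 1) / 2 ^ (k + 1 + d) with hB
  have hAB : A ≤ B := div_le_div_of_nonneg_right (by linarith) hK'.le
  have hA0 : 0 ≤ A := by positivity
  have hB1 : B ≤ 1 := by rw [hB, div_le_one hK']; exact hj''
  -- Step 1: localise to the fine support [A,B]
  have hcont : Continuous fun x => spS k j x * spS (k + 1 + d) j' x :=
    (continuous_spS _ _).mul (continuous_spS _ _)
  rw [integral_eq_integral_of_support hcont (A := A) (B := B)
    (fun y hy => by rw [spS_eq_zero_of_le hy, mul_zero])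
    (fun y hy => by rw [spS_eq_zero_of_ge hy, mul_zero]) hA0 hB1]
  -- Step 2: on [A,B] the coarse factor is a polynomial in the coarse local variable
  set PR : ℝ[X] := if i = 2 * j then PX else if i = 2 * j + 1 then QX else 0 with hPR
  have hPRdeg : PR.natDegree ≤ 6 := by
    rw [hPR]; split_ifs
    · exact natDegree_PX
    · exact natDegree_QX
    · simp
  -- the polynomial in the fine local variable y = 2^(k+1+d) x - j'
  set α : ℝ := 2 ^ k / 2 ^ (k + 1 + d) with hα
  set β : ℝ := 2 ^ k * j' / 2 ^ (k + 1 + d) - j with hβ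
  set G : ℝ → ℝ := fun y => (PR.comp (C α * X + C β)).eval y * sp y with hG
  have hint : ∀ x ∈ uIcc A B, spS k j x * spS (k + 1 + d) j' x = G (2 ^ (k + 1 + d) * x - j') := by
    intro x hx
    obtain ⟨hxA, hxB⟩ := mem_Icc_of_uIcc hAB hx
    have hz0 : 0 ≤ (2:ℝ) ^ (k + 1 + d) * x - j' := by
      have := (div_le_iff₀ hK').1 hxA; linarith
    have hz1 : (2:ℝ) ^ (k + 1 + d) * x - j' ≤ 1 := by
      have := (le_div_iff₀ hK').1 hxB; linarith
    rw [spS_eq_eval_on_descendant hi1 hi2 hz0 hz1, hG]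
    simp only [eval_comp, eval_add, eval_mul, eval_C, eval_X, spS]
    congr 2
    rw [hα, hβ]; field_simp; ring
  rw [integral_congr hint, intervalIntegral.integral_comp_mul_sub G hK'.ne' (j' : ℝ)]
  have eA : (2:ℝ) ^ (k + 1 + d) * A - j' = 0 := by rw [hA]; field_simp; ring
  have eB : (2:ℝ) ^ (k + 1 + d) * B - j' = 1 := by rw [hB]; field_simp; ring
  rw [eA, eB, hG, integral_polynomial_mul_sp _ (natDegree_comp_affine_le hPRdeg α β), smul_zero]

/-- **1-D orthogonality of the dyadic family**: `∫₀¹ spS k j · spS k' j' = 0` for `(k,j) ≠ (k',j')`.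
[folklore] -/
theorem integral_spS_mul_spS {k j k' j' : ℕ} (hj : j < 2 ^ k) (hj' : j' < 2 ^ k')
    (h : (⟨k, j⟩ : ℕ × ℕ) ≠ ⟨k', j'⟩) :
    ∫ x in (0:ℝ)..1, spS k j x * spS k' j' x = 0 := by
  rcases lt_trichotomy k k' with hlt | heq | hgt
  · exact integral_spS_mul_spS_of_lt hlt hj'
  · subst heq
    have hjj : j ≠ j' := fun e => h (by rw [e])
    simp [spS_mul_spS_same_level hjj]
  · rw [show (∫ x in (0:ℝ)..1, spS k j x * spS k' j' x) = ∫ x in (0:ℝ)..1, spS k' j' x * spS k j x from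
      integral_congr fun x _ => mul_comm _ _]
    exact integral_spS_mul_spS_of_lt hgt hj

end

end Summit.NavierStokesRegularity.NavierStokesRegularity.Theorems.Haitani2025.B0

-- v2 2026-08-27T06:40Z: byte-level resubmission to re-trigger the farm olean build lost in the 06:00–06:08Z gate outage; declarations identical to p503933 (41a9eaaf71591408).
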